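import Literature.LinearAlgebra.Matrix.SemisimpleIntegerMatrixClassesFinite
import Literature.LinearAlgebra.Matrix.CompanionMatrix
import Literature.LinearAlgebra.Matrix.JordanFormPolynomials
import Mathlib.LinearAlgebra.Matrix.Charpoly.Minpoly
import Mathlib.LinearAlgebra.Matrix.Reindex
import HarnessLib

/-!
# Integer block-companion matrices: an integer matrix with prescribed characteristic polynomial `∏ dᵢ` and minimal
# polynomial `d₀` (`dᵢ ∣ d₀` monic in `ℤ[x]`) — the rational form over `ℤ`; hence `𝓜_{m,h}(ℤ) ≠ ∅` and the number of
# `GL_n(ℤ)`-classes of semisimple integer matrices with characteristic polynomial `h` is a POSITIVE integer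

[topic LinearAlgebra/Matrix] Lane `lit-hodgefound` (Track 2 foundations library), seat p15 generation 38, row g38-#6 —
the NON-VACUITY companion of g38-#5 `SemisimpleIntegerMatrixClassesFinite` («finitely many classes» is now «finitely
many, and at least one»).  THEOREMS ONLY (no definition, no instance, no named fact; D-0026 net Literature debt `0`;
no `sorry`); the companion matrix and the blockwise calculus are the tree's (`Literature.LinearAlgebra.Matrix.companion`,
`charpoly_companion`, `minpoly_companion`, `charpoly_blockDiagonal'`, `aeval_blockDiagonal'`).

## Sources

K. Hoffman, R. Kunze, *Linear Algebra* (2nd ed., 1971) [HoffmanKunze1971LinearAlgebra], §7.2 (7-19) and Theorem 5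
(the rational form `A = diag(A₁, …, A_r)`, `A_i` the companion matrix of `p_i`, `p_{i+1} ∣ p_i`; «the characteristic
polynomial is `f = p₁ ⋯ p_r`», «the minimal polynomial is `p₁`»); R. A. Horn, C. R. Johnson, *Matrix Analysis*
(2nd ed., 2013) [HornJohnson2013], Thm. 3.3.14 (the companion matrix of a monic polynomial has it as both minimal and
characteristic polynomial) and §0.9.2 (direct sums).  The companion matrix of a monic INTEGER polynomial has integer
entries, so the rational form with integral invariant factors is an integer matrix: S. Marseglia,
[Marseglia2025ModulesOverOrders] §4 (chunk p0009): «Denote by `Mat_{m,h}` the set of integral square matrices with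
minimal polynomial `m` and characteristic polynomial `h`. Since `m` is squarefree, these matrices are semisimple» —
with Thm. 4.1 (`Mat_{m,h}/∼_ℤ ≃` the isomorphism classes of `𝓛(R, V)`, a non-empty set).

## What is formalised

* §1 companion matrices over a commutative ring: base change `(companion a)^f = companion (f ∘ a)` (`companion_map_ringHom`)
  and, for a ring embedding into a field, `χ(companion a) = xⁿ + Σ aᵢxⁱ` (`charpoly_companion_of_injective`,
  `charpoly_companion_coeff`).
* §2 block-companion matrices over a field: `χ = ∏ᵢ (x^{nᵢ} + Σ aᵢⱼxʲ)` and, when every block polynomial divides the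
  block polynomial of `i₀`, `μ =` that polynomial (`charpoly_blockDiagonal'_companion`,
  `minpoly_blockDiagonal'_companion` — Hoffman–Kunze's «f = p₁⋯p_r», «p₁ is the minimal polynomial»).
* §3 over `ℤ`: for monic `d : ι → ℤ[x]` the block-companion matrix `⊕ᵢ companion(dᵢ)` is an INTEGER matrix with
  `χ = ∏ dᵢ` and, if `dᵢ ∣ d_{i₀}` for all `i`, `μ_ℚ = d_{i₀}` (`charpoly_blockDiagonal'_companion_coeff`,
  `minpoly_map_blockDiagonal'_companion_coeff`).
* §4 **existence on `Fin N`, `N = Σ deg dᵢ`** (`exists_int_matrix_charpoly_eq_minpoly_eq`), hence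
  **`𝓜_{m,h}(ℤ) ≠ ∅`** for `m = d_{i₀}`, `h = ∏ dᵢ` (`nonempty_minpoly_charpoly`; the isotypic case `h = m^{s+1}`:
  `nonempty_minpoly_charpoly_pow`), non-emptiness of the semisimple class set when `m` is square-free over `ℚ`
  (`nonempty_isSemisimple_charpoly`), and with g38-#5: **the number of `GL_N(ℤ)`-classes of semisimple integer
  matrices with characteristic polynomial `∏ dᵢ` is a positive natural number** (`natCard_quot_conj_pos`).

## References
* [HoffmanKunze1971LinearAlgebra] K. Hoffman, R. Kunze, *Linear Algebra*, §7.2 (7-19), Theorem 5.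
* [HornJohnson2013] R. A. Horn, C. R. Johnson, *Matrix Analysis*, Thm. 3.3.14, §0.9.2.
* [Marseglia2025ModulesOverOrders] S. Marseglia, Res. Number Theory 11 (2025), §4 (the set `Mat_{m,h}`), Thm. 4.1. [cite: Marseglia2025ModulesOverOrders, §4, chunk p0009]
* [HertlingLarabi2026b] C. Hertling, K. Larabi, arXiv:2602.15748, §1 ([Za38]).
-/

noncomputable section

open scoped Classical
open Polynomial Module

namespace Literature.LinearAlgebra.Matrix.IntegerBlockCompanionMatrices

open Literature.LinearAlgebra.Matrix (companion companion_apply minpoly_companion charpoly_companion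
  aeval_companion_eq_zero monic_X_pow_add_sum charpoly_blockDiagonal' aeval_blockDiagonal')

/-! ## §1 Companion matrices over a commutative ring -/

section Companion

variable {R S : Type*} [CommRing R] [CommRing S]

/-- `x^{deg p} + Σ_{j < deg p} p_j x^j = p` for monic `p`. [folklore] -/
private theorem X_pow_add_sum_coeff_eq {p : R[X]} (hp : p.Monic) :
    X ^ p.natDegree + ∑ j : Fin p.natDegree, C (p.coeff j) * X ^ (j : ℕ) = p := by
  rw [Fin.sum_univ_eq_sum_range (fun j => C (p.coeff j) * X ^ j) p.natDegree]
  exact hp.as_sum.symm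

/-- **The companion matrix commutes with ring homomorphisms**: `(companion a)^f = companion (f ∘ a)` — in particular
the companion matrix of an integer polynomial, read in `ℚ`, is the companion matrix of the same polynomial (the
tree's `Literature.LinearAlgebra.companion_map` is the case of a homomorphism of FIELDS; here any commutative rings,
as needed for `ℤ → ℚ`). [cite: HoffmanKunze1971LinearAlgebra, §7.2 Exercise 12 (the rational form does not depend on the field)] -/
theorem companion_map_ringHom (f : R →+* S) {n : ℕ} (a : Fin n → R) :
    (companion a).map f = companion (f ∘ a) := by
  ext i j
  rw [Matrix.map_apply, companion_apply, companion_apply]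
  split_ifs <;> simp

/-- **Theorem 3.3.14 over a ring embedded in a field**: `χ(companion a) = xⁿ + Σ aᵢ xⁱ`.
[cite: HornJohnson2013, Thm. 3.3.14, p0256] -/
theorem charpoly_companion_of_injective {K : Type*} [Field K] (f : R →+* K) (hf : Function.Injective f) {n : ℕ}
    (a : Fin n → R) : (companion a).charpoly = X ^ n + ∑ i : Fin n, C (a i) * X ^ (i : ℕ) := by
  apply Polynomial.map_injective f hf
  rw [← Matrix.charpoly_map, companion_map_ringHom, charpoly_companion]
  simp [Polynomial.map_add, Polynomial.map_sum, Polynomial.map_pow, Polynomial.map_mul]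

/-- The companion matrix of a monic polynomial `p` over a ring embedded in a field has characteristic polynomial `p`.
[cite: HornJohnson2013, Thm. 3.3.14, p0256] -/
theorem charpoly_companion_coeff {K : Type*} [Field K] (f : R →+* K) (hf : Function.Injective f) {p : R[X]}
    (hp : p.Monic) : (companion fun j : Fin p.natDegree => p.coeff j).charpoly = p := by
  rw [charpoly_companion_of_injective f hf, X_pow_add_sum_coeff_eq hp]

end Companion

/-! ## §2 Block-companion matrices over a field -/

section FieldBlocks

variable {K : Type*} [Field K] {ι : Type*} [Fintype ι] [DecidableEq ι]

/-- **«The characteristic polynomial is `f = p₁ ⋯ p_r`»** for a block-companion matrix.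
[cite: HoffmanKunze1971LinearAlgebra, §7.2 Theorem 4 (proof) and (7-19)] [cite: HornJohnson2013, §0.9.2, p0059] -/
theorem charpoly_blockDiagonal'_companion {n : ι → ℕ} (a : ∀ i, Fin (n i) → K) :
    (Matrix.blockDiagonal' fun i => companion (a i)).charpoly =
      ∏ i, (X ^ (n i) + ∑ j : Fin (n i), C (a i j) * X ^ (j : ℕ)) := by
  rw [charpoly_blockDiagonal']
  exact Finset.prod_congr rfl fun i _ => charpoly_companion (a i)

/-- **«`p₁` is the minimal polynomial»**: if every block polynomial divides the block polynomial of `i₀`, the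
block-companion matrix has that polynomial as minimal polynomial. [cite: HoffmanKunze1971LinearAlgebra, §7.2 Theorem 3 and (7-19)] -/
theorem minpoly_blockDiagonal'_companion {n : ι → ℕ} (a : ∀ i, Fin (n i) → K) (i₀ : ι)
    (hdvd : ∀ i, (X ^ (n i) + ∑ j : Fin (n i), C (a i j) * X ^ (j : ℕ)) ∣
      (X ^ (n i₀) + ∑ j : Fin (n i₀), C (a i₀ j) * X ^ (j : ℕ))) :
    minpoly K (Matrix.blockDiagonal' fun i => companion (a i)) =
      X ^ (n i₀) + ∑ j : Fin (n i₀), C (a i₀ j) * X ^ (j : ℕ) := by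
  symm
  refine minpoly.unique K _ (monic_X_pow_add_sum (a i₀)) ?_ fun g hg hg0 => ?_
  · -- it kills every block
    rw [aeval_blockDiagonal', ← Matrix.blockDiagonal'_zero]
    congr 1
    funext i
    obtain ⟨s, hs⟩ := hdvd i
    rw [hs, map_mul, aeval_companion_eq_zero, zero_mul, Pi.zero_apply]
  · -- minimality, read on the block `i₀`
    have h0 : aeval (companion (a i₀)) g = 0 := by
      rw [aeval_blockDiagonal'] at hg0
      ext i j
      have hij := congr_fun (congr_fun hg0 ⟨i₀, i⟩) ⟨i₀, j⟩
      rwa [Matrix.blockDiagonal'_apply_eq, Matrix.zero_apply] at hij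
    have hdvd' : minpoly K (companion (a i₀)) ∣ g := minpoly.dvd K _ h0
    rw [minpoly_companion] at hdvd'
    exact Polynomial.degree_le_of_dvd hdvd' hg.ne_zero

end FieldBlocks

/-! ## §3 Block-companion matrices over `ℤ` -/

section IntBlocks

variable {ι : Type*} [Fintype ι] [DecidableEq ι]

omit [Fintype ι] in
/-- Base change of a block-companion matrix. [cite: HoffmanKunze1971LinearAlgebra, §7.2 Exercise 12] -/
theorem blockDiagonal'_companion_map {R S : Type*} [CommRing R] [CommRing S] (f : R →+* S) {n : ι → ℕ}
    (a : ∀ i, Fin (n i) → R) :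
    (Matrix.blockDiagonal' fun i => companion (a i)).map f = Matrix.blockDiagonal' fun i => companion (f ∘ a i) := by
  rw [Matrix.blockDiagonal'_map _ f (map_zero f)]
  congr 1
  funext i
  exact companion_map_ringHom f (a i)

/-- **The integer block-companion matrix of monic `d₁, …, d_r ∈ ℤ[x]` has characteristic polynomial `∏ dᵢ`.**
[cite: HoffmanKunze1971LinearAlgebra, §7.2 Theorem 4 (proof, «f = p₁ ⋯ p_r») and (7-19)] -/
theorem charpoly_blockDiagonal'_companion_coeff (d : ι → ℤ[X]) (hd : ∀ i, (d i).Monic) :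
    (Matrix.blockDiagonal' fun i => companion fun j : Fin (d i).natDegree => (d i).coeff j).charpoly = ∏ i, d i := by
  rw [charpoly_blockDiagonal']
  exact Finset.prod_congr rfl fun i _ =>
    charpoly_companion_coeff (Int.castRingHom ℚ) (Int.castRingHom ℚ).injective_int (hd i)

/-- **… and, when `dᵢ ∣ d_{i₀}` for all `i`, minimal polynomial `d_{i₀}` over `ℚ`.**
[cite: HoffmanKunze1971LinearAlgebra, §7.2 Theorem 3 («p₁ is the minimal polynomial») and (7-19)] -/
theorem minpoly_map_blockDiagonal'_companion_coeff (d : ι → ℤ[X]) (hd : ∀ i, (d i).Monic) (i₀ : ι)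
    (hdvd : ∀ i, d i ∣ d i₀) :
    minpoly ℚ ((Matrix.blockDiagonal' fun i => companion fun j : Fin (d i).natDegree => (d i).coeff j).map
      (Int.castRingHom ℚ)) = (d i₀).map (Int.castRingHom ℚ) := by
  rw [blockDiagonal'_companion_map]
  have hq : ∀ i, X ^ (d i).natDegree +
      ∑ j : Fin (d i).natDegree, C ((Int.castRingHom ℚ ∘ fun j : Fin (d i).natDegree => (d i).coeff j) j) *
        X ^ (j : ℕ) = (d i).map (Int.castRingHom ℚ) := fun i => by
    have h := congrArg (Polynomial.map (Int.castRingHom ℚ)) (X_pow_add_sum_coeff_eq (hd i))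
    simp only [Polynomial.map_add, Polynomial.map_pow, Polynomial.map_X, Polynomial.map_sum, Polynomial.map_mul,
      Polynomial.map_C] at h
    simpa only [Function.comp_apply] using h
  rw [minpoly_blockDiagonal'_companion _ i₀ fun i => ?_, hq i₀]
  rw [hq i, hq i₀]
  exact Polynomial.map_dvd _ (hdvd i)

end IntBlocks

/-! ## §4 Existence on `Fin N`; `𝓜_{m,h}(ℤ) ≠ ∅`; the class number is a positive integer -/

section Existence

variable {ι : Type*} [Fintype ι] [DecidableEq ι]

/-- **THE RATIONAL FORM OVER `ℤ` (Hoffman–Kunze §7.2 with integral invariant factors): for monic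
`d : ι → ℤ[x]` with `dᵢ ∣ d_{i₀}` and `N = Σ deg dᵢ` there is an INTEGER `N × N` matrix with characteristic
polynomial `∏ dᵢ` and minimal polynomial `d_{i₀}`** (the block-companion matrix, re-indexed by `Fin N`).
[cite: HoffmanKunze1971LinearAlgebra, §7.2 (7-19), Theorem 3, Theorem 4, Theorem 5] [cite: HornJohnson2013, Thm. 3.3.14, p0256] -/
theorem exists_int_matrix_charpoly_eq_minpoly_eq (d : ι → ℤ[X]) (hd : ∀ i, (d i).Monic) (i₀ : ι)
    (hdvd : ∀ i, d i ∣ d i₀) {N : ℕ} (hN : ∑ i, (d i).natDegree = N) :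
    ∃ B : _root_.Matrix (Fin N) (Fin N) ℤ,
      B.charpoly = ∏ i, d i ∧ minpoly ℚ (B.map (Int.castRingHom ℚ)) = (d i₀).map (Int.castRingHom ℚ) := by
  have hcard : Fintype.card (Σ i, Fin (d i).natDegree) = N := by
    simp only [Fintype.card_sigma, Fintype.card_fin, hN]
  let e : (Σ i, Fin (d i).natDegree) ≃ Fin N := Fintype.equivFinOfCardEq hcard
  refine ⟨Matrix.reindex e e (Matrix.blockDiagonal' fun i => companion fun j : Fin (d i).natDegree => (d i).coeff j),
    (Matrix.charpoly_reindex e _).trans (charpoly_blockDiagonal'_companion_coeff d hd), ?_⟩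
  have h1 := minpoly.algEquiv_eq (Matrix.reindexAlgEquiv ℚ ℚ e)
    ((Matrix.blockDiagonal' fun i => companion fun j : Fin (d i).natDegree => (d i).coeff j).map
      (Int.castRingHom ℚ))
  rw [Matrix.coe_reindexAlgEquiv, minpoly_map_blockDiagonal'_companion_coeff d hd i₀ hdvd] at h1
  exact h1

/-- **`𝓜_{m,h}(ℤ) ≠ ∅`** for `m = d_{i₀}`, `h = ∏ dᵢ` («the set of integral square matrices with minimal polynomial
`m` and characteristic polynomial `h`»). [cite: Marseglia2025ModulesOverOrders, §4 (the set `Mat_{m,h}`) and Thm. 4.1, chunk p0009] [cite: HoffmanKunze1971LinearAlgebra, §7.2 Theorem 5] -/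
theorem nonempty_minpoly_charpoly (d : ι → ℤ[X]) (hd : ∀ i, (d i).Monic) (i₀ : ι) (hdvd : ∀ i, d i ∣ d i₀)
    {N : ℕ} (hN : ∑ i, (d i).natDegree = N) :
    Nonempty {B : _root_.Matrix (Fin N) (Fin N) ℤ //
      minpoly ℚ (B.map (Int.castRingHom ℚ)) = (d i₀).map (Int.castRingHom ℚ) ∧ B.charpoly = ∏ i, d i} := by
  obtain ⟨B, hc, hm⟩ := exists_int_matrix_charpoly_eq_minpoly_eq d hd i₀ hdvd hN
  exact ⟨⟨B, hm, hc⟩⟩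

/-- **The isotypic case `h = m^{s+1}`**: an integer matrix with minimal polynomial `m` and characteristic polynomial
`m^{s+1}` (`s + 1` companion blocks). [cite: Marseglia2025ModulesOverOrders, §4 (`h = m₁^{s₁} ⋯ m_n^{s_n}`), chunk p0009] [cite: HoffmanKunze1971LinearAlgebra, §7.2 (7-19)] -/
theorem nonempty_minpoly_charpoly_pow (m : ℤ[X]) (hm : m.Monic) (s : ℕ) :
    Nonempty {B : _root_.Matrix (Fin ((s + 1) * m.natDegree)) (Fin ((s + 1) * m.natDegree)) ℤ //
      minpoly ℚ (B.map (Int.castRingHom ℚ)) = m.map (Int.castRingHom ℚ) ∧ B.charpoly = m ^ (s + 1)} := by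
  have h := nonempty_minpoly_charpoly (fun _ : Fin (s + 1) => m) (fun _ => hm) 0 (fun _ => dvd_rfl)
    (N := (s + 1) * m.natDegree) (by simp)
  simpa only [Finset.prod_const, Finset.card_univ, Fintype.card_fin] using h

/-- **Non-emptiness of the semisimple class set**: if `d_{i₀}` is square-free over `ℚ`, the block-companion matrix is
semisimple («since `m` is squarefree, these matrices are semisimple»). [cite: Marseglia2025ModulesOverOrders, §4, chunk p0009] -/
theorem nonempty_isSemisimple_charpoly (d : ι → ℤ[X]) (hd : ∀ i, (d i).Monic) (i₀ : ι) (hdvd : ∀ i, d i ∣ d i₀)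
    (hsf : Squarefree ((d i₀).map (Int.castRingHom ℚ))) {N : ℕ} (hN : ∑ i, (d i).natDegree = N) :
    Nonempty {B : _root_.Matrix (Fin N) (Fin N) ℤ //
      Module.End.IsSemisimple (Matrix.toLin' (B.map (Int.castRingHom ℚ))) ∧ B.charpoly = ∏ i, d i} := by
  obtain ⟨B, hc, hm⟩ := exists_int_matrix_charpoly_eq_minpoly_eq d hd i₀ hdvd hN
  refine ⟨⟨B, ?_, hc⟩⟩
  refine Module.End.isSemisimple_of_squarefree_aeval_eq_zero hsf ?_
  rw [← hm, ← Matrix.minpoly_toLin']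
  exact minpoly.aeval ℚ _

/-- **With g38-#5 (Jordan–Zassenhaus): the number of `GL_N(ℤ)`-classes of semisimple integer matrices with
characteristic polynomial `∏ dᵢ` (`dᵢ ∣ d_{i₀}` monic, `d_{i₀}` square-free over `ℚ`) is a POSITIVE natural number.**
[cite: HertlingLarabi2026b, §1 ([Za38])] [cite: Marseglia2025ModulesOverOrders, §3 Rem. 3.3, §4 Thm. 4.1] -/
theorem natCard_quot_conj_pos (d : ι → ℤ[X]) (hd : ∀ i, (d i).Monic) (i₀ : ι) (hdvd : ∀ i, d i ∣ d i₀)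
    (hsf : Squarefree ((d i₀).map (Int.castRingHom ℚ))) {N : ℕ} (hN : ∑ i, (d i).natDegree = N) :
    0 < Nat.card (Quot (fun B B' : {B : _root_.Matrix (Fin N) (Fin N) ℤ //
        Module.End.IsSemisimple (Matrix.toLin' (B.map (Int.castRingHom ℚ))) ∧ B.charpoly = ∏ i, d i} =>
      ∃ P : _root_.Matrix (Fin N) (Fin N) ℤ, IsUnit P.det ∧ P * B.1 = B'.1 * P)) := by
  haveI := SemisimpleIntegerMatrixClassesFinite.finite_quot_conj_semisimple_charpoly N (∏ i, d i)
  obtain ⟨B⟩ := nonempty_isSemisimple_charpoly d hd i₀ hdvd hsf hN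
  exact @Nat.card_pos _ ⟨Quot.mk _ B⟩ inferInstance

end Existence

end Literature.LinearAlgebra.Matrix.IntegerBlockCompanionMatrices
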